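import Literature.NumberTheory.Rogawski1990.ShalikaGermExpansionFarSupport        -- ★ p848018 SH-1 «FAR SUPPORT» (LH4-p03): `exists_nhds_charpolyCoeff_classOrbitalIntegral_eq_zero_of_tsupport`
import Literature.NumberTheory.Rogawski1990.ShalikaGermExpansionInvariantKernel   -- ★ p848037 SH-2 «C₀ KILLED» (LH4-p02): `classOrbitalIntegral_eq_zero_of_mem_span_conj_sub`, `isLocSmooth_of_mem_span_conj_sub`
import Literature.NumberTheory.Automorphic.OrbitalIntegralFinitePieces            -- ★ `classOrbitalIntegral_finset_sum`
import Literature.NumberTheory.Rogawski1990.LocalTransferGlue                     -- ★ `IsLocSmooth.add`, `IsLocSmooth.finset_sum`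
import Literature.NumberTheory.Automorphic.LocalOrbitalIntegralIndicator          -- ★ `UnitaryGroup.integrable_descConj_out_of_isAdmissibleOn` (regular orbital integrands of `C_c` functions converge)
import HarnessLib

/-!
# The Howe ∕ Gelfand–Kazhdan reduction of the Shalika germ expansion at the identity ([Rogawski1990] §8.1, proof of Prop. 8.1.1, p. 113)

Topic `NumberTheory/Rogawski1990`; namespace `Literature.NumberTheory.Rogawski1990`.  THEOREMS ONLY (no definition, no instance, no notation, no named
fact, no `sorry`).  Cell `pub/hodgecm-mathlib`, crux H413 = `stmt-HodgeConjecture-24833`, germ line «N6nsGerm» ED. 1.16″, PRINT residual `stub_N6nsShalika`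
(= ★ def `ShalikaGermExpansionNonsplit L Φ₃ v`, [Rogawski1990, Prop. 8.1.1 p. 112]); organ SH-3 «HOWE REDUCTION» of line LH4 (LH4-plan (g0) words 02:25:28Z ∕
02:31:39Z ∕ «=» 02:32:44Z with pins P1–P3), over SH-1 ★ p848018 (far support) and SH-2 ★ p848037 (`C₀` killed).

THE PRINT PROOF (p. 113, «an argument due to Howe [H] and Gelfand–Kazhdan [GK]», `ε = 1`, `γ = 1`, `ω = 1`).  Let `u_1, …, u_r` be the unipotent classes
and `f_j ∈ C(G)` DUAL PIECES, `Φ(u_k, f_j) = δ_jk` (ll. 1–6).  Put `Γ_{u_j}(δ) := Φ(δ, f_j)` and `F := f − Σ_j Φ(u_j, f) f_j`, so `Φ(u_k, F) = 0` for all `k`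
(ll. 6–7).  With `C₀ := span{φ^g − φ}` (killed by every invariant distribution), the induction over the closures of the unipotent orbits ([H] Prop. 2) shows
that «`F` coincides with an element of `C₀` in an open invariant neighborhood» of `1`: `F = F₀ + F₁`, `F₀ ∈ C₀`, `F₁` vanishing near the unipotent variety
(ll. 7–20) — whence `Φ(δ, F) = 0` and `Φ(δ, f) = Σ_j Φ(u_j, f) Γ_{u_j}(δ)` for regular `δ` near `1`.

THIS FILE proves the DEDUCTION «dual pieces + Howe span ⇒ germ expansion» sorry-free, in the currency of ★ `ShalikaGermExpansionNonsplit` (class-wise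
neighbourhoods of `1` = neighbourhoods `W` of the coefficient vector of `(X − 1)^N = charpoly 1`):
* §1 `exists_nhds_charpolyCoeff_classOrbitalIntegral_eq_sum_of_dualPieces_of_howeSpan` — GENERIC: `G` a topological group with a continuous matrix
  representation `ρ : G →* GL_N(R)` (`R` a Hausdorff topological ring), `m_G` an orbital-measure family admissible on a predicate `Reg` at whose classes the
  orbital integrands of `C_c^∞` functions are integrable (`hint`), ‹DUAL› = a finite set `S` of classes with a family `m_U` satisfying the Ranga-Rao
  integrability clause and dual pieces `fd u ∈ C_c^∞`, `Φ_{m_U}(u, fd u) = 1`, `Φ_{m_U}(u, fd u′) = 0` (`u ≠ u′`) — total shape; `exists_dualPieces_total_of_subtype` converts the `↥S`-indexed Kronecker shape of ★ `OrbitalIntegralDualPieces` (LH4-p02, ‹RANK› ⇒ ‹DUAL›) —, ‹SPAN› = Howe's conclusion «`Φ_{m_U}(u, F) = 0 ∀ u ∈ S` ⇒ `F = F₀ + F₁`,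
  `F₀ ∈ C₀`, `tsupport F₁` off `{(ρ g − 1)^N = 0}`» (span literal of ★ SH-2, far literal of ★ SH-1 verbatim); CONCLUSION: for every `f ∈ C_c^∞` a
  neighbourhood `W` with `Φ_{m_G}(c, f) = Σ_{u ∈ S} Φ_{m_U}(u, f) · Φ_{m_G}(c, fd u)` for every `Reg` class `c` with `coeffs(charpoly ρ(c)) ∈ W` — print's
  germs `Γ_u(c) := Φ(c, f_u)`.  Steps: `F := f − Σ_u Φ_U(u, f) • fd u` is `C_c^∞` (★ `IsLocSmooth.finset_sum`) with `Φ_U(u′, F) = 0` (★ `classOrbitalIntegral_finset_sum`,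
  ★ `orbitalIntegral_sub ∕ _smul` under the Rao clause, `hdual`); ‹SPAN›; `Φ_G(c, F₀) = 0` by ★ SH-2 `classOrbitalIntegral_eq_zero_of_mem_span_conj_sub` under
  `hint`; `Φ_G(c, F₁) = 0` on `W` by ★ SH-1; additivity at `c` under `hint`.
* §2 `UnitaryGroup.shalikaGermExpansionNonsplit_of_howePackage` — THE PLUG concluding ★ `ShalikaGermExpansionNonsplit L H′ v` BY NAME for hermitian `H′`
  with `det H′ ≠ 0` (pin P2: NOT `hanis` — `Φ₃` is isotropic) from ONE hypothesis, the «HOWE PACKAGE» `h`: under the def's instance binders, `∃ S mU fd` with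
  (i) the classes of `S` unipotent, (ii) `mU` admissible on `S`, (iii) the Rao clause — (i)–(iii) = the def's own first three conjuncts VERBATIM —, (iv) `fd u ∈
  C_c^∞`, (v) duality `Φ_{mU}(u, fd u) = 1` ∕ `Φ_{mU}(u, fd u′) = 0` for `u ≠ u′` (two clauses, no `Decidable` instance in the text), (vi) ‹SPAN› at `N = 3`.  The integrability `hint` at the REGULAR classes is NOT assumed: it is ★
  `UnitaryGroup.integrable_descConj_out_of_isAdmissibleOn` (closed regular orbits, ★ `LocalRegularOrbitClosed`).

A2 ∕ VACUITY (pin P3).  The package `h` is CONSISTENT — it is what the print proof establishes: an admissible Ranga-Rao family `mU` on the unipotent classes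
[Rao1972], dual pieces (in-house at the CM places from ★ RANK `exists_levelPieces_det_classOrbitalIntegral_ne_zero` p846543 ∕ its ramified twins by matrix
inversion), and the Howe–Harish-Chandra span property [Howe1974, Prop. 2; Rogawski1990 p. 113 ll. 7–20] — and it is NOT constructible in-house today (no
l-space ∕ invariant-distribution layer in `Literature`).  So §2 is CONDITIONAL BY DESIGN: a re-denomination «Prop. 8.1.1 ⟸ HOWE PACKAGE»; books count-neutral;
the PRINT row `stub_N6nsShalika` is UNCHANGED; nothing here is wired into the germ line or the closer.  HONEST LABEL: HC_CM is proved only modulo the cell's 2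
remaining named inputs (hLiu418 24832, h413 24833) until rung 0 closes; this file asserts nothing printed as proved.

## References
* [Rogawski1990] J. D. Rogawski, *Automorphic Representations of Unitary Groups in Three Variables*, Ann. of Math. Stud. 123 (1990), §8.1 Prop. 8.1.1
  p. 112, proof p. 113.
* [Howe1974] R. Howe, *The Fourier transform and germs of characters (case of `Gl_n` over a `p`-adic field)*, Math. Ann. 208 (1974) 305–322, Prop. 2.
* [Rao1972] R. Ranga Rao, *Orbital integrals in reductive groups*, Ann. of Math. (2) 96 (1972) 505–510.
-/

set_option autoImplicit false

noncomputable section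

open MeasureTheory Measure Set Filter Topology Polynomial
open scoped Matrix MatrixGroups
open Literature.MeasureTheory.Group Literature.NumberTheory.Automorphic

namespace Literature.NumberTheory.Rogawski1990

/-! ## §1 The generic reduction: dual pieces + Howe span ⇒ germ expansion on a charpoly-neighbourhood of `1` -/

section Generic

variable {G : Type*} [Group G] [TopologicalSpace G] [IsTopologicalGroup G]
  {R : Type*} [CommRing R] [TopologicalSpace R] [IsTopologicalRing R] [T2Space R] {N : ℕ}
  [∀ γ : G, MeasurableSpace (G ⧸ Subgroup.centralizer ({γ} : Set G))] [∀ γ : G, BorelSpace (G ⧸ Subgroup.centralizer ({γ} : Set G))]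

/-- **THE HOWE ∕ GELFAND–KAZHDAN REDUCTION (generic).**  `ρ : G →* GL_N(R)` a continuous matrix representation of the topological group `G` over a Hausdorff
topological ring; `m_G` admissible on `Reg` with the orbital integrands of `C_c^∞` functions integrable at the `Reg` classes (`hint`); ‹DUAL›: a finite set `S`
of classes, a family `m_U` with the Ranga-Rao integrability clause on `S`, and dual pieces `fd u ∈ C_c^∞` with `Φ_{m_U}(u, fd u′) = δ_{u u′}` (`u, u′ ∈ S`);
‹SPAN› (Howe): every `F ∈ C_c^∞` killed by all `Φ_{m_U}(u, ·)`, `u ∈ S`, splits as `F = F₀ + F₁` with `F₀ ∈ C₀ = span{φ^x − φ}` and `tsupport F₁` off the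
unipotent variety `{(ρ g − 1)^N = 0}`.  THEN for every `f ∈ C_c^∞(G)` there is a neighbourhood `W` of the coefficient vector of `charpoly 1 = (X − 1)^N` with
`Φ_{m_G}(c, f) = Σ_{u ∈ S} Φ_{m_U}(u, f) · Φ_{m_G}(c, fd u)` for every `Reg` class `c` whose characteristic polynomial has its coefficients in `W` — the germ
expansion with print's germs `Γ_u(c) := Φ(c, f_u)`. [cite: Rogawski1990, §8.1 Prop. 8.1.1 pp. 112–113] [cite: Howe1974, Prop. 2] [cite: Rao1972] -/
theorem exists_nhds_charpolyCoeff_classOrbitalIntegral_eq_sum_of_dualPieces_of_howeSpan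
    (ρ : G →* GL (Fin N) R) (hρ : Continuous fun g : G => ((ρ g : GL (Fin N) R) : Matrix (Fin N) (Fin N) R))
    {Reg : G → Prop} {mG : OrbitalMeasureFamily G} (hmG : mG.IsAdmissibleOn Reg)
    (hint : ∀ c : ConjClasses G, Reg (Quotient.out c) → ∀ φ : G → ℂ, IsLocSmooth φ →
      Integrable (descConj (Quotient.out c : G) (Subgroup.centralizer ({(Quotient.out c : G)} : Set G))
        (fun _ hg => Subgroup.mem_centralizer_singleton_iff.1 hg) φ) (mG c))
    (S : Finset (ConjClasses G)) (mU : OrbitalMeasureFamily G)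
    (hRao : ∀ u ∈ S, ∀ f : G → ℂ, IsLocSmooth f →
      Integrable (descConj (Quotient.out u : G) (Subgroup.centralizer ({(Quotient.out u : G)} : Set G))
        (fun _ hg => Subgroup.mem_centralizer_singleton_iff.1 hg) f) (mU u))
    (fd : ConjClasses G → G → ℂ) (hfd : ∀ u ∈ S, IsLocSmooth (fd u))
    (hdual1 : ∀ u ∈ S, classOrbitalIntegral mU (fd u) u = 1)
    (hdual0 : ∀ u ∈ S, ∀ u' ∈ S, u ≠ u' → classOrbitalIntegral mU (fd u') u = 0)
    (hspan : ∀ F : G → ℂ, IsLocSmooth F → (∀ u ∈ S, classOrbitalIntegral mU F u = 0) →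
      ∃ F₀ F₁ : G → ℂ, F = F₀ + F₁ ∧
        F₀ ∈ Submodule.span ℂ {ψ : G → ℂ | ∃ (x : G) (φ : G → ℂ), IsLocSmooth φ ∧ ψ = (fun g => φ (x * g * x⁻¹)) - φ} ∧
        ∀ g ∈ tsupport F₁, (((ρ g : GL (Fin N) R) : Matrix (Fin N) (Fin N) R) - 1) ^ N ≠ 0)
    (f : G → ℂ) (hf : IsLocSmooth f) :
    ∃ W ∈ 𝓝 (fun i : Fin N => ((1 : Matrix (Fin N) (Fin N) R).charpoly).coeff i),
      ∀ c : ConjClasses G, Reg (Quotient.out c) →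
        (fun i : Fin N => ((ρ (Quotient.out c) : GL (Fin N) R) : Matrix (Fin N) (Fin N) R).charpoly.coeff i) ∈ W →
          classOrbitalIntegral mG f c = ∑ u ∈ S, classOrbitalIntegral mU f u * classOrbitalIntegral mG (fd u) c := by
  classical
  -- `C_c^∞` is stable under the scalings used below
  have hsm : ∀ (a : ℂ) {φ : G → ℂ}, IsLocSmooth φ → IsLocSmooth (a • φ) := fun a φ hφ =>
    ⟨hφ.1.comp fun z => a * z, hφ.2.mono (Function.support_const_smul_subset a φ)⟩
  -- Step 1 (print ll. 6–7): the correction `P := Σ_u Φ_U(u, f) • fd u` and `F := f − P`, with `Φ_U(u′, F) = 0` for `u′ ∈ S`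
  set P : G → ℂ := ∑ u ∈ S, classOrbitalIntegral mU f u • fd u with hP
  have hPs : IsLocSmooth P := IsLocSmooth.finset_sum S fun u hu => hsm _ (hfd u hu)
  set F : G → ℂ := f - P with hF
  have hFs : IsLocSmooth F := ⟨hf.1.sub hPs.1, hf.2.sub hPs.2⟩
  -- the orbital integrals of `P` against any measure at which all `C_c^∞` integrands are integrable
  have hPexp : ∀ (m : OrbitalMeasureFamily G) (c : ConjClasses G),
      (∀ φ : G → ℂ, IsLocSmooth φ →
        Integrable (descConj (Quotient.out c : G) (Subgroup.centralizer ({(Quotient.out c : G)} : Set G))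
          (fun _ hg => Subgroup.mem_centralizer_singleton_iff.1 hg) φ) (m c)) →
      classOrbitalIntegral m P c = ∑ u ∈ S, classOrbitalIntegral mU f u * classOrbitalIntegral m (fd u) c := by
    intro m c hI
    rw [hP, classOrbitalIntegral_finset_sum m S (fun u => classOrbitalIntegral mU f u • fd u) c (fun u hu => hI _ (hsm _ (hfd u hu)))]
    refine Finset.sum_congr rfl fun u _ => ?_
    simp only [classOrbitalIntegral_eq, orbitalIntegral_smul, smul_eq_mul]
  have hFU : ∀ u' ∈ S, classOrbitalIntegral mU F u' = 0 := by
    intro u' hu'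
    have hI := hRao u' hu'
    rw [hF, classOrbitalIntegral_eq, orbitalIntegral_sub _ _ (hI f hf) (hI P hPs), ← classOrbitalIntegral_eq, ← classOrbitalIntegral_eq,
      hPexp mU u' hI, sub_eq_zero]
    rw [Finset.sum_eq_single_of_mem u' hu' fun u hu hne => by rw [hdual0 u' hu' u hu (Ne.symm hne), mul_zero],
      hdual1 u' hu', mul_one]
  -- Step 2 (print ll. 7–20): Howe's span decomposition of `F`
  obtain ⟨F₀, F₁, hFeq, hF₀, hF₁far⟩ := hspan F hFs hFU
  have hF₀s : IsLocSmooth F₀ := isLocSmooth_of_mem_span_conj_sub hF₀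
  have hF₁eq : F₁ = F - F₀ := by rw [hFeq, add_sub_cancel_left]
  have hF₁s : IsLocSmooth F₁ := by rw [hF₁eq]; exact ⟨hFs.1.sub hF₀s.1, hFs.2.sub hF₀s.2⟩
  -- Step 3 (print l. 20, ★ SH-1): the far part vanishes on a charpoly-neighbourhood of `1`
  obtain ⟨W, hW, hfar⟩ :=
    Literature.NumberTheory.Automorphic.exists_nhds_charpolyCoeff_classOrbitalIntegral_eq_zero_of_tsupport ρ hρ mG hF₁s.2 hF₁far
  refine ⟨W, hW, fun c hc hcW => ?_⟩
  have hIc := hint c hc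
  -- `f = F₀ + F₁ + P` and additivity at `c`
  have hfeq : f = F + P := by rw [hF, sub_add_cancel]
  have h1 : classOrbitalIntegral mG f c = classOrbitalIntegral mG F c + classOrbitalIntegral mG P c := by
    rw [hfeq, classOrbitalIntegral_eq, orbitalIntegral_add _ _ (hIc F hFs) (hIc P hPs), ← classOrbitalIntegral_eq, ← classOrbitalIntegral_eq]
  have h2 : classOrbitalIntegral mG F c = classOrbitalIntegral mG F₀ c + classOrbitalIntegral mG F₁ c := by
    rw [hFeq, classOrbitalIntegral_eq, orbitalIntegral_add _ _ (hIc F₀ hF₀s) (hIc F₁ hF₁s), ← classOrbitalIntegral_eq, ← classOrbitalIntegral_eq]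
  -- ★ SH-2: `C₀` is killed at `c`; ★ SH-1: the far part vanishes at `c`
  have h3 : classOrbitalIntegral mG F₀ c = 0 := classOrbitalIntegral_eq_zero_of_mem_span_conj_sub hmG hc hIc hF₀
  have h4 : classOrbitalIntegral mG F₁ c = 0 := hfar c hcW
  rw [h1, h2, h3, h4, zero_add, zero_add, hPexp mG c hIc]

omit [IsTopologicalGroup G] [∀ γ : G, BorelSpace (G ⧸ Subgroup.centralizer ({γ} : Set G))] in
/-- **DUAL PIECES: from the `↥S`-indexed shape to the total shape.**  ★ `exists_dualPieces_of_det_ne_zero` (`OrbitalIntegralDualPieces`, the ‹RANK› ⇒ ‹DUAL›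
organ) delivers dual pieces indexed by the subtype `↥S` with a Kronecker identity; the head above wants a TOTAL `fd : ConjClasses G → (G → ℂ)` with the
duality split into the diagonal and off-diagonal clauses (no `Decidable` instance in the statement).  Extension by `0` off `S`.
[cite: Rogawski1990, §8.1 Prop. 8.1.1 p. 113] -/
theorem exists_dualPieces_total_of_subtype (S : Finset (ConjClasses G)) (mU : OrbitalMeasureFamily G)
    (fdS : ↥S → G → ℂ) (hfdS : ∀ u : ↥S, IsLocSmooth (fdS u))
    (h1 : ∀ u : ↥S, classOrbitalIntegral mU (fdS u) (u : ConjClasses G) = 1)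
    (h0 : ∀ u u' : ↥S, u' ≠ u → classOrbitalIntegral mU (fdS u) (u' : ConjClasses G) = 0) :
    ∃ fd : ConjClasses G → G → ℂ, (∀ u ∈ S, IsLocSmooth (fd u)) ∧ (∀ u ∈ S, classOrbitalIntegral mU (fd u) u = 1) ∧
      ∀ u ∈ S, ∀ u' ∈ S, u ≠ u' → classOrbitalIntegral mU (fd u') u = 0 := by
  classical
  refine ⟨fun c => if h : c ∈ S then fdS ⟨c, h⟩ else 0, fun u hu => ?_, fun u hu => ?_, fun u hu u' hu' hne => ?_⟩
  · simp only [dif_pos hu]; exact hfdS _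
  · simp only [dif_pos hu]; exact h1 ⟨u, hu⟩
  · simp only [dif_pos hu']
    exact h0 ⟨u', hu'⟩ ⟨u, hu⟩ fun h => hne (congrArg Subtype.val h)

end Generic

/-! ## §2 The plug: ★ `ShalikaGermExpansionNonsplit L H′ v` from the Howe package (`N = 3`, hermitian `H′` with `det H′ ≠ 0`) -/

section Plug

open NumberField IsDedekindDomain Literature.NumberTheory.Automorphic.UnitaryGroup

variable (L : Type) [Field L] [NumberField L] [IsCMField L] (H' : Matrix (Fin 3) (Fin 3) L)
  (v : HeightOneSpectrum (𝓞 ↥(maximalRealSubfield L)))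

set_option maxHeartbeats 400000 in
-- statement-heavy: the seven-conjunct Howe package under four instance binders
/-- **THE PLUG — ★ `ShalikaGermExpansionNonsplit L H′ v` ⟸ THE HOWE PACKAGE** (hermitian `H′`, `det H′ ≠ 0`).  The package `h` (under the named fact's own
instance binders): a finite set `S` of UNIPOTENT classes of `U(H′)(L⁺_v)`, a family `m_U` ADMISSIBLE on `S` with the RANGA-RAO clause (these three = the named
fact's first three conjuncts verbatim), DUAL PIECES `fd u ∈ C_c^∞` with `Φ_{m_U}(u, fd u′) = δ_{u u′}`, and HOWE'S SPAN PROPERTY for `(S, m_U)`.  Conclusion: the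
named fact, with germs `Γ_u(c) := Φ_{m_G}(c, fd u)`; the convergence of the REGULAR orbital integrals is supplied by ★ `UnitaryGroup.integrable_descConj_out_of_isAdmissibleOn`.
CONDITIONAL BY DESIGN (module docstring, A2): re-denomination «Prop. 8.1.1 ⟸ HOWE PACKAGE», books count-neutral, PRINT row `stub_N6nsShalika` unchanged.
[cite: Rogawski1990, §8.1 Prop. 8.1.1 pp. 112–113] [cite: Howe1974, Prop. 2] [cite: Rao1972] -/
theorem UnitaryGroup.shalikaGermExpansionNonsplit_of_howePackage (hH' : (H'.map (cmConjRingHom L))ᵀ = H') (hdet : H'.det ≠ 0)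
    (h : ∀ [MeasurableSpace ((cmDatum L 3 H').Local v)] [BorelSpace ((cmDatum L 3 H').Local v)]
      [∀ γ : (cmDatum L 3 H').Local v,
        MeasurableSpace (((cmDatum L 3 H').Local v) ⧸ Subgroup.centralizer ({γ} : Set ((cmDatum L 3 H').Local v)))]
      [∀ γ : (cmDatum L 3 H').Local v,
        BorelSpace (((cmDatum L 3 H').Local v) ⧸ Subgroup.centralizer ({γ} : Set ((cmDatum L 3 H').Local v)))],
      ∃ (S : Finset (ConjClasses ((cmDatum L 3 H').Local v))) (mU : OrbitalMeasureFamily ((cmDatum L 3 H').Local v))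
        (fd : ConjClasses ((cmDatum L 3 H').Local v) → (cmDatum L 3 H').Local v → ℂ),
        (∀ u ∈ S, (((Quotient.out u : (cmDatum L 3 H').Local v).val : GL (Fin 3) (UnitaryGroup.LocalRing L v)).val - 1) ^ 3 = 0) ∧
        mU.IsAdmissibleOn (fun γ => (ConjClasses.mk γ) ∈ S) ∧
        (∀ u ∈ S, ∀ f : (cmDatum L 3 H').Local v → ℂ, IsLocSmooth f →
          Integrable (descConj (Quotient.out u : (cmDatum L 3 H').Local v)
            (Subgroup.centralizer ({(Quotient.out u : (cmDatum L 3 H').Local v)} : Set ((cmDatum L 3 H').Local v)))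
            (fun _ hg => Subgroup.mem_centralizer_singleton_iff.1 hg) f) (mU u)) ∧
        (∀ u ∈ S, IsLocSmooth (fd u)) ∧
        (∀ u ∈ S, classOrbitalIntegral mU (fd u) u = 1) ∧
        (∀ u ∈ S, ∀ u' ∈ S, u ≠ u' → classOrbitalIntegral mU (fd u') u = 0) ∧
        (∀ F : (cmDatum L 3 H').Local v → ℂ, IsLocSmooth F → (∀ u ∈ S, classOrbitalIntegral mU F u = 0) →
          ∃ F₀ F₁ : (cmDatum L 3 H').Local v → ℂ, F = F₀ + F₁ ∧
            F₀ ∈ Submodule.span ℂ {ψ : (cmDatum L 3 H').Local v → ℂ |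
              ∃ (x : (cmDatum L 3 H').Local v) (φ : (cmDatum L 3 H').Local v → ℂ), IsLocSmooth φ ∧ ψ = (fun g => φ (x * g * x⁻¹)) - φ} ∧
            ∀ g ∈ tsupport F₁, ((g.val : GL (Fin 3) (UnitaryGroup.LocalRing L v)).val - 1) ^ 3 ≠ 0)) :
    ShalikaGermExpansionNonsplit L H' v := by
  intro _ _ _ _ mG hmG
  obtain ⟨S, mU, fd, hunip, hmU, hRao, hfd, hdual1, hdual0, hspan⟩ := h
  -- the inclusion `U(H′)(L⁺_v) ≤ GL₃(∏_{w ∣ v} L_w)` as a continuous matrix representation (typed on the datum, so that the generic head's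
  -- instances are the datum's canonical ones)
  let ρ : (cmDatum L 3 H').Local v →* GL (Fin 3) (UnitaryGroup.LocalRing L v) :=
    { toFun := fun γ => γ.val, map_one' := rfl, map_mul' := fun _ _ => rfl }
  have hρ : Continuous fun g : (cmDatum L 3 H').Local v => ((ρ g).val : Matrix (Fin 3) (Fin 3) (UnitaryGroup.LocalRing L v)) :=
    Units.continuous_val.comp continuous_subtype_val
  refine ⟨S, mU, fun u c => classOrbitalIntegral mG (fd u) c, hunip, hmU, hRao, fun f hf => ?_⟩
  obtain ⟨W, hW, hmain⟩ :=
    exists_nhds_charpolyCoeff_classOrbitalIntegral_eq_sum_of_dualPieces_of_howeSpan ρ hρ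
      (Reg := fun γ : (cmDatum L 3 H').Local v => IsRegularElt (γ.val : GL (Fin 3) (UnitaryGroup.LocalRing L v))) hmG
      (fun c hc φ hφ => UnitaryGroup.integrable_descConj_out_of_isAdmissibleOn L 3 H' v hH' hdet hmG c hc hφ.continuous hφ.2)
      S mU hRao fd hfd hdual1 hdual0 hspan f hf
  exact ⟨W, hW, fun c hc hcW => hmain c hc hcW⟩

end Plug

end Literature.NumberTheory.Rogawski1990

end
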